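import Summits.CriticalPhenomena.Ising3DConformalLimit.Theses.HyperoctahedralRP
import Literature.MathematicalPhysics.QuantumFieldTheory.MirrorRPKernel
import Summits.CriticalPhenomena.Ising3DConformalLimit.Theorems.PrecisionLaplacianStableConeRPRigidityPeriodicTypeLiouville
import Summits.CriticalPhenomena.Ising3DConformalLimit.Theorems.PrecisionLaplacianStableConeRPRigidityPlanarRigidityLemma
import Summits.CriticalPhenomena.Ising3DConformalLimit.Theorems.PrecisionLaplacianStableConeRPRigidityXRayReduction
import Summits.CriticalPhenomena.Ising3DConformalLimit.Theorems.HyperoctahedralRPHRP2RigidityMellinAxialSymmetry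
import Summits.CriticalPhenomena.Ising3DConformalLimit.Theorems.HyperoctahedralRPHRP2RigidityStripTilingEntire
import Summits.CriticalPhenomena.Ising3DConformalLimit.Theorems.PrecisionLaplacianStableConeRPRigidityProbedXRayRP
import Summits.CriticalPhenomena.Ising3DConformalLimit.Theorems.HyperoctahedralRPHRP2RigidityHalfPlaneContinuation

/-!
# Crux `HyperoctahedralRP.HRP2Rigidity` (stmt-CriticalPhenomena-1979) — PROOF, line `xray-mellin-transfer` (all stubs landed)

Line lead prover-line-stmt-CriticalPhenomena-1979-0, 2026-08-16.  PIVOT recorded in `Cruxes/HRP2Rigidity/PICKED.md`: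
the opening pick `bounded-phase-quadric-liouville` (k-side: Stieltjes pencils ⇒ bounded-phase leaf continuations ⇒
Liouville) isolates two OPEN cores on `1/2 < Δ ≤ 1` (`stub_noSpacelikeMass`, `stub_polarPhase`); after that pick the
crux-ideate / crux-plan seats of the SIBLING crux `PrecisionLaplacian.StableConeRPRigidity` (stmt-CriticalPhenomena-4800)
published a line whose composition proves THIS crux by name with NO open stub (card `riesz-probe-xray-mellin`, cross-filed
on this item as evidence 2026-08-16T00:21Z; skeleton `Cruxes/StableConeRPRigidity/Lines/entire-profile-null-growth.lean`,
bonus theorem `HRP2Rigidity_of`; audited stub-by-stub TRUE by that crux's standing disprover, `Cruxes/StableConeRPRigidity/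
Disproof.lean` §S, 2026-08-16T01:30Z).  This file runs that line for item 1979: its seven stub statements were registered
VERBATIM as on stmt-4800 (definition-free texts over Mathlib + `IsMirrorRPKernel`), so that every stub landed for either crux
discharged it for both; all seven are now landed Theorems files and are IMPORTED above (two proved by this line's seats —
S2, S7 —, S1 by the lead on the new Literature pair `Analysis/OperatorTheory/HalfLinePositiveDefinite{,Holomorphic}`, and
S3–S6 by the sibling crux's seats); what remains here is the kernel-checked composition.

THE LINE (x-side throughout; general degree `-β`, `0 < β < 4`; the crux is `β = 2Δ ∈ [1, 2]`).
* LEVER S1–S4 = PLANAR FOUR-LINE RIGIDITY.  Per mirror `n`, RP + `θ_n`-invariance + evenness + slab bounds make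
  `t ↦ K(t n̂ + y)` (`y ⊥ n`) the restriction of a function holomorphic on `{Re t > 0}` dominated by `K((Re t) n̂)`
  (S1: the `2m`-point configurations `{s_a n̂} ∪ {s_a n̂ - y}` make `K(s n̂) ± K(s n̂ + y)` positive definite on the
  half-line semigroup, hence Laplace transforms — Bernstein–Widder); in the plane, homogeneity turns the half-plane in
  the normal variable into the strip `{0 < Re ω < π/2}` of the complexified polar angle, the two OBLIQUE normals `e₀`,
  `e₀ + e₁` have disjoint exceptional lines, so the angular profile `κ(ω) = k(cos ω e₀ + sin ω e₁)` is ENTIRE of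
  exponential type `β` (S2), the quarter turn makes it `π/2`-periodic, and a `T`-periodic entire function of type `β`
  with `βT < 2π` is constant (S3, Fourier coefficients by contour shift): `k` is radial for every `0 < β < 4` (S4).
* TRANSFER `d = 3 ⇒ d = 2` (S5–S7).  For an axis `eᵢ` and the four lattice mirrors `n ⊥ eᵢ`, the PROBED X-RAY
  `y ↦ ∫ K(y + s eᵢ)|s|^{-δ} ds` (`0 < δ < 1 < β + δ`) is again RP for `n` (S5: RP Gram matrices on the grids
  `p_a + jh eᵢ` Schur-multiplied by the positive-definite Toeplitz matrices of the Gaussian mixtures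
  `h_ε ↑ |s|^{-δ}`, Fejér/Riemann limits), continuous, positive, homogeneous of degree `-(β + δ - 1) ∈ (-4, 0)` and
  four-line invariant on `eᵢ^⊥ ≅ ℝ²`, hence RADIAL by S4 (S6); `δ ↦ ∫ K(ŷ + s eᵢ)|s|^{-δ} ds = 2·mellin(K(ŷ + ·eᵢ))(1-δ)`
  on an interval of `δ` determines the even continuous `s ↦ K(ŷ + s eᵢ)` (Mellin = Fourier after `s = e^{-u}`,
  `Measure.ext_of_charFun`), so `K` is axially symmetric about every `eᵢ`, hence `O(3)`-invariant (S7).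
  Window: `δ < 1`, `β + δ > 1`, `β + δ - 1 < 4` — non-empty iff `β < 4`.

DISPROOF USED (`Cruxes/HRP2Rigidity/Disproof.lean`, gen-2 cycle 2, F1–F13, read 2026-08-16T01:10Z):
`hrp2Rigidity_false_without_RP` (RP load-bearing) — RP enters at S1 (the Laplace representation IS reflection
positivity), at S5 (Schur) and through S5 at S6; `footpoint_bound` ("all that `m ≤ 2` gives") — S1 uses the `2m`-point
configurations, S5 the grids; F2/F9 (seven rigid circles, `a = 1` leaf monotonicity) — by-products not needed: the
off-web great circles where F7/F11/F12 locate the k-side difficulty are never visited (they are integrated out by the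
X-ray and recovered by Mellin uniqueness); F4 dead families — none is a stub instance; the landed `Negative/LoadBearing`
and `Negative/Descent` lemmas refute no stub (every stub keeps RP among its hypotheses or is pure function theory).
Sibling disprover's TARGET (`StableConeRPRigidity/Disproof.lean` `axialProbe_not_RPAt`): the POINTWISE kernel
`K·|xᵢ|^{-δ}` is not RP (junk/infinite diagonal) — S5 below is the X-RAY statement (the singularity is integrated,
`δ < 1`), proved on grids or with the regularised weights `(xᵢ² + ε²)^{-δ/2}`, never the pointwise one.
-/

open MeasureTheory
open scoped BigOperators

namespace Summit.CriticalPhenomena.Ising3DConformalLimit.Cruxes.HRP2Rigidity.XRayMellin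

open Summit.CriticalPhenomena.Ising3DConformalLimit.Theses

noncomputable section

/-! ## All seven registered stubs are LANDED and imported (this file is complete)

LANDED (2026-08-16): S1 `stub_halfPlaneContinuation` (this line, `Theorems/HyperoctahedralRPHRP2RigidityHalfPlaneContinuation.lean`,
on the Literature pair `Analysis/OperatorTheory/HalfLinePositiveDefinite{,Holomorphic}.lean`: GNS shift semigroup + spectral Laplace
representation + identity-theorem gluing); S3 `stub_periodicTypeLiouville`, S4 `stub_planarRigidityLemma`, S5 `stub_probedXRayRP`,
S6 `stub_xRayReduction` (sibling crux stmt-4800, namespace `…StableConeRPRigidity.EntireProfileNullGrowth`, files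
`Theorems/PrecisionLaplacianStableConeRPRigidity{PeriodicTypeLiouville,PlanarRigidityLemma,ProbedXRayRP,XRayReduction}.lean`);
S2 `stub_stripTilingEntire` (p75558) and S7 `stub_mellinAxialSymmetry` (p75215) (this line, namespace `…HRP2Rigidity.XRayMellin`,
files `Theorems/HyperoctahedralRPHRP2Rigidity{StripTilingEntire,MellinAxialSymmetry}.lean`).
-/

/-! ## The composition (kernel-checked): the stubs prove the crux BY NAME -/

/-- **Nine-mirror RP rigidity for every degree `0 < β < 4`** (`C⁺` of the transfer) from the seven stubs: S4 (fed
S1–S3) is planar rigidity; for each probe exponent `δ ∈ (max(0, 1-β), 1)` S6 (fed S5 and S4) makes the probed axial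
X-rays radial; S7 concludes. -/
theorem nineMirrorRigidityBelowFour :
    ∀ (β : ℝ) (K : EuclideanSpace ℝ (Fin 3) → ℝ), 0 < β → β < 4 →
      ContinuousOn K {0}ᶜ → (∀ x, x ≠ 0 → 0 < K x) →
      (∀ c : ℝ, 0 < c → ∀ x, K (c • x) = c ^ (-β) * K x) →
      (∀ n : EuclideanSpace ℝ (Fin 3), (∃ i j : Fin 3, i ≠ j ∧ (n = EuclideanSpace.single i 1 ∨
          n = EuclideanSpace.single i 1 + EuclideanSpace.single j 1 ∨
          n = EuclideanSpace.single i 1 - EuclideanSpace.single j 1)) →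
        (∀ x, K (((ℝ ∙ n)ᗮ).reflection x) = K x) ∧
          Literature.MathematicalPhysics.QuantumFieldTheory.IsMirrorRPKernel n K) →
      ∀ (R : EuclideanSpace ℝ (Fin 3) ≃ₗᵢ[ℝ] EuclideanSpace ℝ (Fin 3)) (x : EuclideanSpace ℝ (Fin 3)),
        K (R x) = K x := by
  intro β K hβ0 hβ4 hKc hKp hhom hmir
  have hplanar := _root_.Summit.CriticalPhenomena.Ising3DConformalLimit.Cruxes.StableConeRPRigidity.EntireProfileNullGrowth.stub_planarRigidityLemma
    stub_halfPlaneContinuation stub_stripTilingEntire _root_.Summit.CriticalPhenomena.Ising3DConformalLimit.Cruxes.StableConeRPRigidity.EntireProfileNullGrowth.stub_periodicTypeLiouville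
  refine stub_mellinAxialSymmetry β K hβ0 hKc hKp hhom (fun n hn => (hmir n hn).1) ?_
  intro δ hδ0 hδβ hδ1
  exact _root_.Summit.CriticalPhenomena.Ising3DConformalLimit.Cruxes.StableConeRPRigidity.EntireProfileNullGrowth.stub_xRayReduction
    _root_.Summit.CriticalPhenomena.Ising3DConformalLimit.Cruxes.StableConeRPRigidity.EntireProfileNullGrowth.stub_probedXRayRP hplanar β δ K hδ0 hδ1 (by linarith) (by linarith) hKc hKp hhom hmir

/-- **`HRP2Rigidity_of`** — the crux `HyperoctahedralRP.HRP2Rigidity` (item stmt-CriticalPhenomena-1979) from the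
seven stubs: `β := 2Δ ∈ [1, 2] ⊂ (0, 4)`; the RP conjunct of the crux is `IsMirrorRPKernel n K` definitionally. -/
theorem HRP2Rigidity_of :
    _root_.Summit.CriticalPhenomena.Ising3DConformalLimit.Theses.HyperoctahedralRP.HRP2Rigidity := by
  intro Δ K hΔ1 hΔ2 hKc hKp hhom hmir
  exact nineMirrorRigidityBelowFour (2 * Δ) K (by linarith) (by linarith) hKc hKp hhom hmir

end

end Summit.CriticalPhenomena.Ising3DConformalLimit.Cruxes.HRP2Rigidity.XRayMellin
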